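import Summits.BirchSwinnertonDyer.BirchSwinnertonDyer.Theorems.ByReductionTypeAtTwoAdditivePotMultConjATwoNarrowTwo3596Field
import Summits.BirchSwinnertonDyer.BirchSwinnertonDyer.Theorems.ByReductionTypeAtTwoFineSelmerConjAAtTwoAdditivePotGoodNarrowRankCertificate316LayerOneDyadic
import Summits.BirchSwinnertonDyer.BirchSwinnertonDyer.Theorems.ByReductionTypeAtTwoAdditivePotMultConjATwoNarrowRoadKitSquares
import HarnessLib

/-!
# C4″ `AdditivePotMultOverKAtTwo` (item stmt-BirchSwinnertonDyer-22618), the (I1M′) input of the upper half on the `0 < Δ` rows: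
# LAYER-TWO NARROW CERTIFICATE `d = 3596`, part DYADIC — the integers `θ, ξ = √2/(1 + θ), √2` of `A₁ = ℚ(θ) ⊔ ℚ_1` and its two dyadic
# primes `(ξ)`, `(η)` (`2 = vξ²η⁴`), the ring identities of `ℤ[θ,ξ]` used downstream, and `h(A₁)` ODD (KERNEL; rows 417136bf1)

Cell `bsd-2adic`, rung K4, seat `bsd-2adic-k4-w3` GEN 13 (explicit unit of director-bsd g16 (309)(7); `--supports stmt-BirchSwinnertonDyer-22618`).
HONEST FRAMING (D-0036/D-0054/D-0152): THEOREMS ONLY (no definition, no named fact, no `sorry`, no instance). The series `…NarrowTwo3596{Class, Field,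
Dyadic, Residues, TotPos, Integers, Parity, SignsA/B/C, Units, Rows}` carries k4-w1 GEN 11's zero-hypothesis LAYER-TWO narrow certificate (row `261648q1`,
`…NarrowRankCertificate316*`: `h(A₁)`, `h(A₂)` odd by genus theory with one dyadic non-norm unit, ONE totally positive non-square unit of `A₁ = ℚ(θ,√2)`,
ELEVEN sign-independent units of `A₂ = ℚ(θ,√(2+√2))`, k4-w2's Edgar–Mollin–Peterson door `a = 1, b = 11`, cruxlead-19573-w2's rung `m = 1`) to the
totally real cubic `2`-torsion field of discriminant `3596` (`X³ + (0)X² + (-11)X + (-8)`) of the C4″ census rows 417136bf1 (eng-2 CERT-ADD-POTMULT-POS81-AB-E2: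
`n₀ = 0`, `rank₂ Cl⁺ = [0,1,1]`, unit signature ranks `[3,5,11]`, `h = 1` at layers `0,1,2` — letter NARROW-EQUAL12, instrument grade `grh`; here KERNEL).
All certificates were found by the seat's exact-arithmetic tools (`k4w3/gen13/tools`: GEN 12 `narrowcert/unitlib` + layer-two arithmetic `nf12/cert2`) and are CHECKED
HERE by the kernel. Statement (A) is NOT BSD: BSD₂ for these curves is not proved; C4″ / (I1M′) stay research-open; nothing booked; no row of 22618 changes tier
(pen RC-490 (4)); BSD is not proved by any of this.

References: [CoatesSujatha2005] Conj. A, Thm. 3.4; [Fukuda1994] Thm. 1 (2); [EdgarMollinPeterson1986] Thm. 2.1; [FrohlichTaylor1990] Ch. V §1 (1.8)–(1.13);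
[Lang1990] Ch. 13 §4 Lemma 4.1; [Washington1997] §13.1, Prop. 13.2; [Cohen1993] §4.1.3, §6.3; [Marcus1977] Ch. 5 Thm. 22, 35–37; [Omeara1963] §63.
-/

set_option autoImplicit false
-- sibling precedent: the directory name repeats the summit name
set_option linter.dupNamespace false

noncomputable section

open scoped Classical IntermediateField NumberField nonZeroDivisors Polynomial

namespace Summit.BirchSwinnertonDyer.BirchSwinnertonDyer.Theorems.AddKatoTwo

open Polynomial IsDedekindDomain NumberField Field IntermediateField
  Literature.NumberTheory.EllipticCurves Literature.NumberTheory.EllipticCurves.ZpExtension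
  Literature.NumberTheory.IwasawaTheory Literature.NumberTheory.NumberFields
  Literature.NumberTheory.GaloisRepresentations Literature.Geometry.Kaehler.ComplexTorus

variable {θ : AlgebraicClosure ℚ}

/-- **Ring identities of `ℤ[θ, ξ]`** (`θ³ + (0)θ² + (-11)θ + (-8) = 0`, `ξ² = 42 + 3 * θ - 4 * θ ^ 2`; `ξ = √2/(1 + θ)`): the dyadic factorisation
`2 = v·ξ²·η⁴` (`η = 5 + θ - θ ^ 2 - θ ^ 2 * ξ`, `(1 + θ) = v′·η²`, `v, v′` units), `w = vη⁴ ≡ 1`, `μ ≡ 1 (mod ξ)` with `ξμ = 2 + (1 + θ)ξ`,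
and for the unit `ε = -3 - 3 * θ + θ ^ 2`: `ε − 1 = ξ⁴κ`, `κ ≡ 1 (mod ξ)`; in any commutative ring. [folklore] [cite: Cohen1993, §4.8.2 and §6.3] -/
theorem layer_one_ids_d3596 {R : Type*} [CommRing R] (bA xA : R) (Rb : -8 - 11 * bA + bA ^ 3 = 0) (Rx : xA ^ 2 = 42 + 3 * bA - 4 * bA ^ 2) :
    (28417 + 5616 * xA + 1472 * bA + 1210 * bA * xA - 2548 * bA ^ 2 - 790 * bA ^ 2 * xA) * xA ^ 2 * (5 + bA - bA ^ 2 - bA ^ 2 * xA) ^ 4 = 2 ∧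
    (28417 + 5616 * xA + 1472 * bA + 1210 * bA * xA - 2548 * bA ^ 2 - 790 * bA ^ 2 * xA) * (5 + bA - bA ^ 2 - bA ^ 2 * xA) ^ 4 = 1 + 2 * bA + bA ^ 2 ∧
    (1 + 2 * bA + bA ^ 2) - 1 = xA * (16 * xA + 27 * bA * xA + 8 * bA ^ 2 * xA) ∧
    xA * (1 + xA + bA + 2 * bA * xA + bA ^ 2 * xA) = 2 + (1 + bA) * xA ∧
    (1 + xA + bA + 2 * bA * xA + bA ^ 2 * xA) - 1 = xA * (1 + 4 * xA + 2 * bA + 6 * bA * xA + bA ^ 2 + bA ^ 2 * xA) ∧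
    (-3 - 3 * bA + bA ^ 2) - 1 = xA ^ 4 * (-23 - 33 * bA - 4 * bA ^ 2) ∧
    (-23 - 33 * bA - 4 * bA ^ 2) - 1 = xA * (-176 * xA - 282 * bA * xA - 69 * bA ^ 2 * xA) ∧
    1 + bA = (137 + 8 * xA + 19 * bA - 13 * bA * xA - 15 * bA ^ 2 + bA ^ 2 * xA) * (5 + bA - bA ^ 2 - bA ^ 2 * xA) ^ 2 ∧
    (137 + 8 * xA + 19 * bA - 13 * bA * xA - 15 * bA ^ 2 + bA ^ 2 * xA) * (137 - 8 * xA + 19 * bA + 13 * bA * xA - 15 * bA ^ 2 - bA ^ 2 * xA) = 1 ∧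
    (28417 + 5616 * xA + 1472 * bA + 1210 * bA * xA - 2548 * bA ^ 2 - 790 * bA ^ 2 * xA) * (28417 - 5616 * xA + 1472 * bA - 1210 * bA * xA - 2548 * bA ^ 2 + 790 * bA ^ 2 * xA) = 1 ∧
    (-3 - 3 * bA + bA ^ 2) * (-11 - bA + bA ^ 2) = 1 := by
  refine ⟨?_, ?_, ?_, ?_, ?_, ?_, ?_, ?_, ?_, ?_, ?_⟩
  · linear_combination ((-13499482895 : R) + (3510000 : R) * xA + (-41155671644 : R) * bA + (286610650 : R) * bA * xA + (-31085604886 : R) * bA ^ 2 + (1201570046 : R) * bA ^ 2 * xA + (14308880102 : R) * bA ^ 3 + (-2808000 : R) * bA ^ 2 * xA ^ 2 + (1903625368 : R) * bA ^ 3 * xA + (21683976591 : R) * bA ^ 4 + (-40029320 : R) * bA ^ 3 * xA ^ 2 + (1053277680 : R) * bA ^ 4 * xA + (209090126 : R) * bA ^ 5 + (-64624234 : R) * bA ^ 4 * xA ^ 2 + (-233643526 : R) * bA ^ 5 * xA + (-4206372193 : R) * bA ^ 6 + (842400 : R) * bA ^ 4 * xA ^ 3 + (1092228 : R) * bA ^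 5 * xA ^ 2 + (-305519498 : R) * bA ^ 6 * xA + (-282892662 : R) * bA ^ 7 + (2405436 : R) * bA ^ 5 * xA ^ 3 + (35985528 : R) * bA ^ 6 * xA ^ 2 + (-5065806 : R) * bA ^ 7 * xA + (339353941 : R) * bA ^ 8 + (2218432 : R) * bA ^ 6 * xA ^ 3 + (4010077 : R) * bA ^ 7 * xA ^ 2 + (27852694 : R) * bA ^ 8 * xA + (16469280 : R) * bA ^ 9 + (-112320 : R) * bA ^ 6 * xA ^ 4 + (4996 : R) * bA ^ 7 * xA ^ 3 + (-5149326 : R) * bA ^ 8 * xA ^ 2 + (993902 : R) * bA ^ 9 * xA + (-10241524 : R) * bA ^ 10 + (-46664 : R) * bA ^ 7 * xA ^ 4 + (-409258 : R) * bA ^ 8 * xA ^ 3 + (-368748 : R) * bA ^ 9 * xA ^ 2 + (-883414 : R) * bA ^ 10 * xA + (61841 : R) * bA ^ 8 * xA ^ 4 + (-21210 : R) * bA ^ 9 * xA ^ 3 + (232704 : R) * bA ^ 10 * xA ^ 2 + (5616 : R) * bA ^ 8 * xA ^ 5 + (9472 : R) * bA ^ 9 * xA ^ 4 + (19828 : R)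 * bA ^ 10 * xA ^ 3 + (1210 : R) * bA ^ 9 * xA ^ 5 + (-5708 : R) * bA ^ 10 * xA ^ 4 + (-790 : R) * bA ^ 10 * xA ^ 5) * Rx + ((70872285199 : R) + (-18427500 : R) * xA + (123680190068 : R) * bA + (-1689655440 : R) * xA ^ 2 + (-1480684350 : R) * bA * xA + (1822799727 : R) * bA ^ 2 + (-2823073788 : R) * bA * xA ^ 2 + (-4378025754 : R) * bA ^ 2 * xA + (-77689668500 : R) * bA ^ 3 + (35380800 : R) * bA * xA ^ 3 + (12118154 : R) * bA ^ 2 * xA ^ 2 + (-4283834650 : R) * bA ^ 3 * xA + (-12466191638 : R) * bA ^ 4 + (103555512 : R) * bA ^ 2 * xA ^ 3 + (1773165796 : R) * bA ^ 3 * xA ^ 2 + (62404790 : R) * bA ^ 4 * xA + (15294089136 : R) * bA ^ 5 + (97020852 : R) * bA ^ 3 * xA ^ 3 + (272010906 : R) * bA ^ 4 * xA ^ 2 + (1150402260 : R) * bA ^ 5 * xA + (2106452387 : R) * bA ^ 6 + (-4717440 : R) * bA ^ 3 * xA ^ 4 + (-2756616 : R) * bA ^ 4 * xA ^ 3 + (-348183573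 : R) * bA ^ 5 * xA ^ 2 + (100950088 : R) * bA ^ 6 * xA + (-1287524876 : R) * bA ^ 7 + (-2296848 : R) * bA ^ 4 * xA ^ 4 + (-26047576 : R) * bA ^ 5 * xA ^ 3 + (-46975702 : R) * bA ^ 6 * xA ^ 2 + (-106662242 : R) * bA ^ 7 * xA + (-96601692 : R) * bA ^ 8 + (2906610 : R) * bA ^ 5 * xA ^ 4 + (-2138578 : R) * bA ^ 6 * xA ^ 3 + (29264628 : R) * bA ^ 7 * xA ^ 2 + (-6625850 : R) * bA ^ 8 * xA + (40966096 : R) * bA ^ 9 + (235872 : R) * bA ^ 5 * xA ^ 5 + (770003 : R) * bA ^ 6 * xA ^ 4 + (2406178 : R) * bA ^ 7 * xA ^ 3 + (2173104 : R) * bA ^ 8 * xA ^ 2 + (3533656 : R) * bA ^ 9 * xA + (67668 : R) * bA ^ 6 * xA ^ 5 + (-458684 : R) * bA ^ 7 * xA ^ 4 + (144324 : R) * bA ^ 8 * xA ^ 3 + (-930816 : R) * bA ^ 9 * xA ^ 2 + (-52014 : R) * bA ^ 7 * xA ^ 5 + (-55012 : R) * bA ^ 8 * xA ^ 4 + (-79312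 : R) * bA ^ 9 * xA ^ 3 + (-7210 : R) * bA ^ 8 * xA ^ 5 + (22832 : R) * bA ^ 9 * xA ^ 4 + (3160 : R) * bA ^ 9 * xA ^ 5) * Rb
  · linear_combination ((-2808000 : R) * bA ^ 2 + (-40029320 : R) * bA ^ 3 + (-64624234 : R) * bA ^ 4 + (842400 : R) * bA ^ 4 * xA + (1092228 : R) * bA ^ 5 + (2405436 : R) * bA ^ 5 * xA + (35985528 : R) * bA ^ 6 + (2218432 : R) * bA ^ 6 * xA + (4010077 : R) * bA ^ 7 + (-112320 : R) * bA ^ 6 * xA ^ 2 + (4996 : R) * bA ^ 7 * xA + (-5149326 : R) * bA ^ 8 + (-46664 : R) * bA ^ 7 * xA ^ 2 + (-409258 : R) * bA ^ 8 * xA + (-368748 : R) * bA ^ 9 + (61841 : R) * bA ^ 8 * xA ^ 2 + (-21210 : R) * bA ^ 9 * xA + (232704 : R) * bA ^ 10 + (5616 : R) * bA ^ 8 * xA ^ 3 + (9472 : R) * bA ^ 9 * xA ^ 2 + (19828 : R) * bA ^ 10 * xA + (1210 : R) * bA ^ 9 * xA ^ 3 + (-5708 : R) * bA ^ 10 * xA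 ^ 2 + (-790 : R) * bA ^ 10 * xA ^ 3) * Rx + ((-2220078 : R) + (-438750 : R) * xA + (1161545 : R) * bA + (157750 : R) * bA * xA + (14495182 : R) * bA ^ 2 + (1790950 : R) * bA ^ 2 * xA + (192216790 : R) * bA ^ 3 + (-1060890 : R) * bA ^ 3 * xA + (88348132 : R) * bA ^ 4 + (-4717440 : R) * bA ^ 3 * xA ^ 2 + (-3956812 : R) * bA ^ 4 * xA + (-121486396 : R) * bA ^ 5 + (-2296848 : R) * bA ^ 4 * xA ^ 2 + (-7912436 : R) * bA ^ 5 * xA + (-30506422 : R) * bA ^ 6 + (2906610 : R) * bA ^ 5 * xA ^ 2 + (-1144676 : R) * bA ^ 6 * xA + (19023104 : R) * bA ^ 7 + (235872 : R) * bA ^ 5 * xA ^ 3 + (770003 : R) * bA ^ 6 * xA ^ 2 + (1522764 : R) * bA ^ 7 * xA + (2173104 : R) * bA ^ 8 + (67668 : R) * bA ^ 6 * xA ^ 3 + (-458684 : R) * bA ^ 7 * xA ^ 2 + (144324 : R) * bA ^ 8 * xA + (-930816 : R) * bA ^ 9 + (-52014 : R) * bA ^ 7 * xA ^ 3 + (-55012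 : R) * bA ^ 8 * xA ^ 2 + (-79312 : R) * bA ^ 9 * xA + (-7210 : R) * bA ^ 8 * xA ^ 3 + (22832 : R) * bA ^ 9 * xA ^ 2 + (3160 : R) * bA ^ 9 * xA ^ 3) * Rb
  · linear_combination ((-16 : R) + (-27 : R) * bA + (-8 : R) * bA ^ 2) * Rx + ((84 : R) + (32 : R) * bA) * Rb
  · linear_combination ((1 : R) + (2 : R) * bA + (1 : R) * bA ^ 2) * Rx + ((-5 : R) + (-4 : R) * bA) * Rb
  · linear_combination ((-4 : R) + (-6 : R) * bA + (-1 : R) * bA ^ 2) * Rx + ((21 : R) + (4 : R) * bA) * Rb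
  · linear_combination ((6 : R) + (7 : R) * bA + (23 : R) * xA ^ 2 + (-1 : R) * bA ^ 2 + (33 : R) * bA * xA ^ 2 + (4 : R) * bA ^ 2 * xA ^ 2) * Rx + ((-31 : R) + (4 : R) * bA + (-120 : R) * xA ^ 2 + (-16 : R) * bA * xA ^ 2) * Rb
  · linear_combination ((176 : R) + (282 : R) * bA + (69 : R) * bA ^ 2) * Rx + ((-921 : R) + (-276 : R) * bA) * Rb
  · linear_combination ((80 : R) * bA ^ 2 + (-114 : R) * bA ^ 3 + (-169 : R) * bA ^ 4 + (-8 : R) * bA ^ 4 * xA + (9 : R) * bA ^ 5 + (13 : R) * bA ^ 5 * xA + (13 : R) * bA ^ 6 + (-1 : R) * bA ^ 6 * xA) * Rx + ((428 : R) + (25 : R) * xA + (-358 : R) * bA + (-65 : R) * bA * xA + (-105 : R) * bA ^ 2 + (-104 : R) * bA ^ 2 * xA + (692 : R) * bA ^ 3 + (102 : R) * bA ^ 3 * xA + (3 : R) * bA ^ 4 + (-55 : R) * bA ^ 4 * xA + (-52 : R) * bA ^ 5 + (4 : R) * bA ^ 5 * xA) * Rb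
  · linear_combination ((-64 : R) + (208 : R) * bA + (-185 : R) * bA ^ 2 + (26 : R) * bA ^ 3 + (-1 : R) * bA ^ 4) * Rx + ((-2010 : R) + (1045 : R) * bA + (-107 : R) * bA ^ 2 + (4 : R) * bA ^ 3) * Rb
  · linear_combination ((-31539456 : R) + (-13590720 : R) * bA + (7409180 : R) * bA ^ 2 + (1911800 : R) * bA ^ 3 + (-624100 : R) * bA ^ 4) * Rx + ((64641408 : R) + (-16160816 : R) * bA + (-9519500 : R) * bA ^ 2 + (2496400 : R) * bA ^ 3) * Rb
  · linear_combination ((0 : R)) * Rx + ((-4 : R) + (1 : R) * bA) * Rb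

/-- **Ring identities for the totally positive unit `u₊ = -47 - 90 * ξ - 72 * θ - 95 * θ * ξ + 24 * θ ^ 2 + 35 * θ ^ 2 * ξ` of `ℤ[θ, ξ]`**: its inverse, and
`u₊ − 1 = ξ^3·ρ₁`, `u₊ − (1 + ξ² + ξ³w) = ξ^2·ρ₂` with `ρ₁ ≡ ρ₂ ≡ 1 (mod ξ)` (`u₊` lies in neither class of unit squares modulo `ξ⁵`). [folklore] -/
theorem layer_one_uplus_ids_d3596 {R : Type*} [CommRing R] (bA xA : R) (Rb : -8 - 11 * bA + bA ^ 3 = 0) (Rx : xA ^ 2 = 42 + 3 * bA - 4 * bA ^ 2) :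
    (-47 - 90 * xA - 72 * bA - 95 * bA * xA + 24 * bA ^ 2 + 35 * bA ^ 2 * xA) * (2361 - 390 * xA + 176 * bA - 35 * bA * xA - 226 * bA ^ 2 + 35 * bA ^ 2 * xA) = 1 ∧
    (-47 - 90 * xA - 72 * bA - 95 * bA * xA + 24 * bA ^ 2 + 35 * bA ^ 2 * xA) - 1 = xA ^ 3 * (-145 - 156 * xA - 135 * bA - 120 * bA * xA + 70 * bA ^ 2 + 108 * bA ^ 2 * xA) ∧
    (-47 - 90 * xA - 72 * bA - 95 * bA * xA + 24 * bA ^ 2 + 35 * bA ^ 2 * xA) - (1 + xA ^ 2 + xA ^ 3 * (1 + 2 * bA + bA ^ 2)) = xA ^ 2 * (-121 - 146 * xA - 120 * bA - 137 * bA * xA + 48 * bA ^ 2 + 69 * bA ^ 2 * xA) ∧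
    (-145 - 156 * xA - 135 * bA - 120 * bA * xA + 70 * bA ^ 2 + 108 * bA ^ 2 * xA) - 1 = xA * (-156 - 53 * xA - 120 * bA + 94 * bA * xA + 108 * bA ^ 2 + 212 * bA ^ 2 * xA) ∧
    (-121 - 146 * xA - 120 * bA - 137 * bA * xA + 48 * bA ^ 2 + 69 * bA ^ 2 * xA) - 1 = xA * (-146 - 157 * xA - 137 * bA - 122 * bA * xA + 69 * bA ^ 2 + 107 * bA ^ 2 * xA) := by
  refine ⟨?_, ?_, ?_, ?_, ?_⟩
  · linear_combination ((35100 : R) + (40200 : R) * bA + (-13475 : R) * bA ^ 2 + (-4550 : R) * bA ^ 3 + (1225 : R) * bA ^ 4) * Rx + ((-170404 : R) + (24270 : R) * xA + (32376 : R) * bA + (-7070 : R) * bA * xA + (21875 : R) * bA ^ 2 + (-4900 : R) * bA ^ 3) * Rb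
  · linear_combination ((120 : R) + (145 : R) * xA + (120 : R) * bA + (156 : R) * xA ^ 2 + (135 : R) * bA * xA + (-48 : R) * bA ^ 2 + (120 : R) * bA * xA ^ 2 + (-70 : R) * bA ^ 2 * xA + (-108 : R) * bA ^ 2 * xA ^ 2) * Rx + ((-624 : R) + (-750 : R) * xA + (192 : R) * bA + (-804 : R) * xA ^ 2 + (280 : R) * bA * xA + (432 : R) * bA * xA ^ 2) * Rb
  · linear_combination ((120 : R) + (145 : R) * xA + (120 : R) * bA + (135 : R) * bA * xA + (-48 : R) * bA ^ 2 + (-70 : R) * bA ^ 2 * xA) * Rx + ((-624 : R) + (-750 : R) * xA + (192 : R) * bA + (280 : R) * bA * xA) * Rb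
  · linear_combination ((53 : R) + (-94 : R) * bA + (-212 : R) * bA ^ 2) * Rx + ((-260 : R) + (848 : R) * bA) * Rb
  · linear_combination ((157 : R) + (122 : R) * bA + (-107 : R) * bA ^ 2) * Rx + ((-809 : R) + (428 : R) * bA) * Rb

set_option linter.unusedSimpArgs false in
set_option maxHeartbeats 1600000 in
/-- **The integers `b = θ`, `ξ = √2/(1 + θ)`, `t = √2` of `A₁ = ℚ(θ) ⊔ ℚ_1` (`θ³ + (0)θ² + (-11)θ + (-8) = 0`, `d = 3596`) and the dyadic primes of `A₁`**:
`ξ·(1 + θ) = t`, `ξ² = 42 + 3 * θ - 4 * θ ^ 2`, `t² = 2`; `ξ` is a PRIME ELEMENT (`|N(ξ)| = 2`) with residues `{0, 1}`, `ξ ∤ w`, `ξ ∤ μ`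
(`e((ξ)|2) = 2`, `f = 1`); `(ξ)` and `(η)`, `η = 5 + θ - θ ^ 2 - θ ^ 2 * ξ`, are prime ideals and `2 = v ξ² η⁴` with `v` a unit (ALL the primes of `A₁`
above `2`). KERNEL (k4-w1's `layer_one_dyadic_d316` transported to `d = 3596`). [cite: Cohen1993, §4.8.2 and §6.3] [cite: Marcus1977, Ch. 3 Thm. 22] [cite: Washington1997, §13.1] -/
theorem layer_one_dyadic_d3596 (hθ : aeval θ (Cubic.toPoly ⟨1, ((0 : ℤ) : ℚ), ((-11 : ℤ) : ℚ), ((-8 : ℤ) : ℚ)⟩) = 0)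
    {t : AlgebraicClosure ℚ} (ht : t ∈ (CyclotomicZp.zpExtension 2).layer 1) (ht2 : t ^ 2 = 2) :
    haveI : FiniteDimensional ℚ ↥ℚ⟮θ⟯ :=
      IntermediateField.adjoin.finiteDimensional ⟨_, Cubic.monic_of_a_eq_one', by rwa [← aeval_def]⟩
    haveI : FiniteDimensional ℚ ↥((CyclotomicZp.zpExtension 2).layer 1) := (CyclotomicZp.zpExtension 2).finiteDimensional_layer_holds 1
    ∃ bA xA sA v : 𝓞 ↥(ℚ⟮θ⟯ ⊔ (CyclotomicZp.zpExtension 2).layer 1),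
      (bA : ↥(ℚ⟮θ⟯ ⊔ (CyclotomicZp.zpExtension 2).layer 1)) = inclusion (le_sup_left : ℚ⟮θ⟯ ≤ ℚ⟮θ⟯ ⊔ (CyclotomicZp.zpExtension 2).layer 1) (AdjoinSimple.gen ℚ θ) ∧
      (sA : ↥(ℚ⟮θ⟯ ⊔ (CyclotomicZp.zpExtension 2).layer 1)) = ⟨t, (le_sup_right : (CyclotomicZp.zpExtension 2).layer 1 ≤ _) ht⟩ ∧
      (xA : ↥(ℚ⟮θ⟯ ⊔ (CyclotomicZp.zpExtension 2).layer 1)) = (⟨t, (le_sup_right : (CyclotomicZp.zpExtension 2).layer 1 ≤ _) ht⟩ : ↥(ℚ⟮θ⟯ ⊔ (CyclotomicZp.zpExtension 2).layer 1)) * (10 + (inclusion (le_sup_left : ℚ⟮θ⟯ ≤ ℚ⟮θ⟯ ⊔ (CyclotomicZp.zpExtension 2).layer 1) (AdjoinSimple.gen ℚ θ)) - (inclusion (le_sup_left : ℚ⟮θ⟯ ≤ ℚ⟮θ⟯ ⊔ (CyclotomicZp.zpExtension 2).layer 1) (AdjoinSimple.gen ℚ θ)) ^ 2) / 2 ∧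
      -8 - 11 * bA + bA ^ 3 = 0 ∧ xA ^ 2 = 42 + 3 * bA - 4 * bA ^ 2 ∧ xA * (1 + bA) = sA ∧ sA ^ 2 = 2 ∧
      Prime xA ∧ (∀ z : 𝓞 ↥(ℚ⟮θ⟯ ⊔ (CyclotomicZp.zpExtension 2).layer 1), xA ∣ z ∨ xA ∣ z - 1) ∧ ¬ xA ∣ (1 + 2 * bA + bA ^ 2) ∧
      ¬ xA ∣ (1 + xA + bA + 2 * bA * xA + bA ^ 2 * xA) ∧ (Ideal.span {xA}).IsPrime ∧ (Ideal.span {5 + bA - bA ^ 2 - bA ^ 2 * xA}).IsPrime ∧ IsUnit v ∧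
      v * xA ^ 2 * (5 + bA - bA ^ 2 - bA ^ 2 * xA) ^ 4 = 2 := by
  haveI : FiniteDimensional ℚ ↥ℚ⟮θ⟯ :=
    IntermediateField.adjoin.finiteDimensional ⟨_, Cubic.monic_of_a_eq_one', by rwa [← aeval_def]⟩
  haveI : FiniteDimensional ℚ ↥((CyclotomicZp.zpExtension 2).layer 1) := (CyclotomicZp.zpExtension 2).finiteDimensional_layer_holds 1
  haveI : NumberField ↥ℚ⟮θ⟯ := NumberField.mk
  haveI : NumberField ↥(ℚ⟮θ⟯ ⊔ (CyclotomicZp.zpExtension 2).layer 1) := NumberField.mk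
  obtain ⟨-, hfinA, h3⟩ := layer_one_basics irreducible_cubic_d3596p hθ (isTotallyReal_adjoin_d3596p hθ)
  have hKA : ℚ⟮θ⟯ ≤ ℚ⟮θ⟯ ⊔ (CyclotomicZp.zpExtension 2).layer 1 := le_sup_left
  have htA : t ∈ ℚ⟮θ⟯ ⊔ (CyclotomicZp.zpExtension 2).layer 1 := (le_sup_right : (CyclotomicZp.zpExtension 2).layer 1 ≤ _) ht
  set t' : ↥(ℚ⟮θ⟯ ⊔ (CyclotomicZp.zpExtension 2).layer 1) := ⟨t, htA⟩ with ht'def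
  have ht'2 : t' ^ 2 = 2 := by
    apply (algebraMap ↥(ℚ⟮θ⟯ ⊔ (CyclotomicZp.zpExtension 2).layer 1) (AlgebraicClosure ℚ)).injective
    rw [map_pow, map_ofNat]
    exact ht2
  letI : Algebra ↥ℚ⟮θ⟯ ↥(ℚ⟮θ⟯ ⊔ (CyclotomicZp.zpExtension 2).layer 1) := (inclusion hKA).toRingHom.toAlgebra
  have halg : ∀ c : ↥ℚ⟮θ⟯, algebraMap ↥ℚ⟮θ⟯ ↥(ℚ⟮θ⟯ ⊔ (CyclotomicZp.zpExtension 2).layer 1) c = inclusion hKA c := fun _ => rfl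
  haveI : IsScalarTower ℚ ↥ℚ⟮θ⟯ ↥(ℚ⟮θ⟯ ⊔ (CyclotomicZp.zpExtension 2).layer 1) :=
    IsScalarTower.of_algebraMap_eq fun q => ((inclusion hKA).commutes q).symm
  haveI : Module.Finite ↥ℚ⟮θ⟯ ↥(ℚ⟮θ⟯ ⊔ (CyclotomicZp.zpExtension 2).layer 1) := Module.Finite.of_restrictScalars_finite ℚ ↥ℚ⟮θ⟯ _
  have hdeg : Module.finrank ↥ℚ⟮θ⟯ ↥(ℚ⟮θ⟯ ⊔ (CyclotomicZp.zpExtension 2).layer 1) = 2 := by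
    have htower := Module.finrank_mul_finrank ℚ ↥ℚ⟮θ⟯ ↥(ℚ⟮θ⟯ ⊔ (CyclotomicZp.zpExtension 2).layer 1)
    rw [h3, hfinA] at htower
    omega
  obtain ⟨b, hbθ, hb⟩ := exists_ringOfIntegers_cubic_root (p := 0) (q := -11) (r := -8) hθ
  have hb' : -8 - 11 * b + b ^ 3 = 0 := by push_cast at hb; linear_combination hb
  have hbgen : algebraMap (𝓞 ↥ℚ⟮θ⟯) ↥ℚ⟮θ⟯ b = AdjoinSimple.gen ℚ θ := Subtype.ext hbθ
  set θ' : ↥(ℚ⟮θ⟯ ⊔ (CyclotomicZp.zpExtension 2).layer 1) := inclusion hKA (AdjoinSimple.gen ℚ θ) with hθ'def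
  set bA : 𝓞 ↥(ℚ⟮θ⟯ ⊔ (CyclotomicZp.zpExtension 2).layer 1) := algebraMap (𝓞 ↥ℚ⟮θ⟯) (𝓞 ↥(ℚ⟮θ⟯ ⊔ (CyclotomicZp.zpExtension 2).layer 1)) b with hbAdef
  have RbA : -8 - 11 * bA + bA ^ 3 = 0 := by
    have h := congrArg (algebraMap (𝓞 ↥ℚ⟮θ⟯) (𝓞 ↥(ℚ⟮θ⟯ ⊔ (CyclotomicZp.zpExtension 2).layer 1))) hb'
    simp only [map_add, map_sub, map_mul, map_pow, map_ofNat, map_zero, map_neg] at h; exact h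
  have hbAval : algebraMap (𝓞 ↥(ℚ⟮θ⟯ ⊔ (CyclotomicZp.zpExtension 2).layer 1)) ↥(ℚ⟮θ⟯ ⊔ (CyclotomicZp.zpExtension 2).layer 1) bA = θ' := by
    rw [hbAdef, hθ'def, ← IsScalarTower.algebraMap_apply,
      IsScalarTower.algebraMap_apply (𝓞 ↥ℚ⟮θ⟯) ↥ℚ⟮θ⟯ ↥(ℚ⟮θ⟯ ⊔ (CyclotomicZp.zpExtension 2).layer 1), hbgen, halg]
  have hbAval' : (bA : ↥(ℚ⟮θ⟯ ⊔ (CyclotomicZp.zpExtension 2).layer 1)) = θ' := hbAval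
  have hθ'rel : -8 - 11 * θ' + θ' ^ 3 = 0 := by
    have h := congrArg (algebraMap (𝓞 ↥(ℚ⟮θ⟯ ⊔ (CyclotomicZp.zpExtension 2).layer 1)) ↥(ℚ⟮θ⟯ ⊔ (CyclotomicZp.zpExtension 2).layer 1)) RbA
    simp only [map_add, map_sub, map_mul, map_pow, map_ofNat, map_zero, map_neg, hbAval] at h; exact h
  set ξ' : ↥(ℚ⟮θ⟯ ⊔ (CyclotomicZp.zpExtension 2).layer 1) := t' * (10 + θ' - θ' ^ 2) / 2 with hξ'def
  have hξq : ξ' * (1 + θ') = t' := by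
    rw [hξ'def]; linear_combination (((-1 : ↥(ℚ⟮θ⟯ ⊔ (CyclotomicZp.zpExtension 2).layer 1)) / 2) * t') * hθ'rel
  have hξsq : ξ' ^ 2 = 42 + 3 * θ' - 4 * θ' ^ 2 := by
    rw [hξ'def]
    linear_combination (((100 : ↥(ℚ⟮θ⟯ ⊔ (CyclotomicZp.zpExtension 2).layer 1)) + (20 : ↥(ℚ⟮θ⟯ ⊔ (CyclotomicZp.zpExtension 2).layer 1)) * θ' + (-19 : ↥(ℚ⟮θ⟯ ⊔ (CyclotomicZp.zpExtension 2).layer 1)) * θ' ^ 2 + (-2 : ↥(ℚ⟮θ⟯ ⊔ (CyclotomicZp.zpExtension 2).layer 1)) * θ' ^ 3 + (1 : ↥(ℚ⟮θ⟯ ⊔ (CyclotomicZp.zpExtension 2).layer 1)) * θ' ^ 4) / 4) * ht'2 + ((-1 : ↥(ℚ⟮θ⟯ ⊔ (CyclotomicZp.zpExtension 2).layer 1)) + ((1 : ↥(ℚ⟮θ⟯ ⊔ (CyclotomicZp.zpExtension 2).layer 1)) / 2) * θ') * hθ'rel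
  have hcoeW : algebraMap (𝓞 ↥(ℚ⟮θ⟯ ⊔ (CyclotomicZp.zpExtension 2).layer 1)) ↥(ℚ⟮θ⟯ ⊔ (CyclotomicZp.zpExtension 2).layer 1) (42 + 3 * bA - 4 * bA ^ 2) = 42 + 3 * θ' - 4 * θ' ^ 2 := by
    simp only [map_add, map_sub, map_mul, map_pow, map_ofNat, map_neg, hbAval]
  have hξint : IsIntegral ℤ ξ' := by
    refine IsIntegral.of_pow two_pos ?_
    rw [hξsq, ← hcoeW]
    exact NumberField.RingOfIntegers.isIntegral_coe _
  set xA : 𝓞 ↥(ℚ⟮θ⟯ ⊔ (CyclotomicZp.zpExtension 2).layer 1) := ⟨ξ', hξint⟩ with hxAdef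
  have hxAval : algebraMap (𝓞 ↥(ℚ⟮θ⟯ ⊔ (CyclotomicZp.zpExtension 2).layer 1)) ↥(ℚ⟮θ⟯ ⊔ (CyclotomicZp.zpExtension 2).layer 1) xA = ξ' := rfl
  have RxA : xA ^ 2 = 42 + 3 * bA - 4 * bA ^ 2 := by
    apply NumberField.RingOfIntegers.coe_injective
    rw [map_pow, hxAval, hcoeW, hξsq]
  have hsint : IsIntegral ℤ t' := ⟨X ^ 2 - C 2, monic_X_pow_sub_C _ two_ne_zero, by simp [ht'2]⟩
  set sA : 𝓞 ↥(ℚ⟮θ⟯ ⊔ (CyclotomicZp.zpExtension 2).layer 1) := ⟨t', hsint⟩ with hsAdef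
  have hsAval : algebraMap (𝓞 ↥(ℚ⟮θ⟯ ⊔ (CyclotomicZp.zpExtension 2).layer 1)) ↥(ℚ⟮θ⟯ ⊔ (CyclotomicZp.zpExtension 2).layer 1) sA = t' := rfl
  have hcoeQ : algebraMap (𝓞 ↥(ℚ⟮θ⟯ ⊔ (CyclotomicZp.zpExtension 2).layer 1)) ↥(ℚ⟮θ⟯ ⊔ (CyclotomicZp.zpExtension 2).layer 1) (1 + bA) = 1 + θ' := by
    simp only [map_add, map_sub, map_mul, map_pow, map_ofNat, map_neg, map_one, hbAval]
  have hs : xA * (1 + bA) = sA := by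
    apply NumberField.RingOfIntegers.coe_injective
    rw [map_mul, hxAval, hcoeQ, hsAval, hξq]
  have hsA2 : sA ^ 2 = 2 := by
    apply NumberField.RingOfIntegers.coe_injective
    rw [map_pow, hsAval, ht'2, map_ofNat]
  obtain ⟨htwo, hwdef, hw1, -, hmu1, -, -, hpiq, hv'inv, hvinv, -⟩ := layer_one_ids_d3596 bA xA RbA RxA
  -- norms: `|N(π_𝔮)| = 2` in `ℚ(θ)`, `= 4` in `A₁`
  have hNq : (Algebra.norm ℤ ((1 + b) : 𝓞 ↥ℚ⟮θ⟯)).natAbs = 2 := by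
    have hN := natAbs_norm_coords_eq_natAbs_normPoly ↥ℚ⟮θ⟯ h3 b (p := 0) (q := -11) (r := -8) irreducible_cubic_d3596p hb (1) (1) (0)
    have he : (((1 : ℤ) : 𝓞 ↥ℚ⟮θ⟯) + ((1 : ℤ) : 𝓞 ↥ℚ⟮θ⟯) * b + ((0 : ℤ) : 𝓞 ↥ℚ⟮θ⟯) * b ^ 2) = 1 + b := by push_cast; ring
    rw [he] at hN; rw [hN]; norm_num
  haveI : Module.Free ↥ℚ⟮θ⟯ ↥(ℚ⟮θ⟯ ⊔ (CyclotomicZp.zpExtension 2).layer 1) := Module.Free.of_divisionRing _ _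
  have hNqA : (Algebra.norm ℤ ((1 + bA) : 𝓞 ↥(ℚ⟮θ⟯ ⊔ (CyclotomicZp.zpExtension 2).layer 1))).natAbs = 4 := by
    have hgA : (((1 + bA) : 𝓞 ↥(ℚ⟮θ⟯ ⊔ (CyclotomicZp.zpExtension 2).layer 1)) : ↥(ℚ⟮θ⟯ ⊔ (CyclotomicZp.zpExtension 2).layer 1)) = algebraMap ↥ℚ⟮θ⟯ ↥(ℚ⟮θ⟯ ⊔ (CyclotomicZp.zpExtension 2).layer 1) (1 + (AdjoinSimple.gen ℚ θ)) := by
      rw [halg, NumberField.RingOfIntegers.coe_eq_algebraMap]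
      simp only [map_add, map_sub, map_mul, map_pow, map_one, map_ofNat, map_neg, hbAval, hθ'def]
    have h2 : Algebra.norm ℚ (algebraMap ↥ℚ⟮θ⟯ ↥(ℚ⟮θ⟯ ⊔ (CyclotomicZp.zpExtension 2).layer 1) (1 + (AdjoinSimple.gen ℚ θ))) =
        (Algebra.norm ℚ (1 + (AdjoinSimple.gen ℚ θ))) ^ 2 := by
      rw [← Algebra.norm_norm (R := ℚ) (S := ↥ℚ⟮θ⟯) (a := algebraMap ↥ℚ⟮θ⟯ ↥(ℚ⟮θ⟯ ⊔ (CyclotomicZp.zpExtension 2).layer 1) (1 + (AdjoinSimple.gen ℚ θ))),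
        Algebra.norm_algebraMap, hdeg, map_pow]
    have h3' : Algebra.norm ℚ (1 + (AdjoinSimple.gen ℚ θ)) = (Algebra.norm ℤ ((1 + b) : 𝓞 ↥ℚ⟮θ⟯) : ℚ) := by
      rw [Algebra.coe_norm_int, ← hbgen]; push_cast; simp only [map_add, map_sub, map_mul, map_pow, map_one, map_ofNat, map_neg]
    have h1 : (Algebra.norm ℤ ((1 + bA) : 𝓞 ↥(ℚ⟮θ⟯ ⊔ (CyclotomicZp.zpExtension 2).layer 1)) : ℚ) = ((Algebra.norm ℤ ((1 + b) : 𝓞 ↥ℚ⟮θ⟯)) ^ 2 : ℤ) := by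
      rw [Algebra.coe_norm_int, hgA, h2, h3']; push_cast; ring
    have h4 : Algebra.norm ℤ ((1 + bA) : 𝓞 ↥(ℚ⟮θ⟯ ⊔ (CyclotomicZp.zpExtension 2).layer 1)) = (Algebra.norm ℤ ((1 + b) : 𝓞 ↥ℚ⟮θ⟯)) ^ 2 := by exact_mod_cast h1
    rw [h4, Int.natAbs_pow, hNq]
  -- `|N(η)| = 2` from `π_𝔮 = v′η²`, then `|N(ξ)| = 2` from `2 = v ξ² η⁴`
  set η : 𝓞 ↥(ℚ⟮θ⟯ ⊔ (CyclotomicZp.zpExtension 2).layer 1) := 5 + bA - bA ^ 2 - bA ^ 2 * xA with hηdef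
  set v' : 𝓞 ↥(ℚ⟮θ⟯ ⊔ (CyclotomicZp.zpExtension 2).layer 1) := 137 + 8 * xA + 19 * bA - 13 * bA * xA - 15 * bA ^ 2 + bA ^ 2 * xA with hv'def
  set v : 𝓞 ↥(ℚ⟮θ⟯ ⊔ (CyclotomicZp.zpExtension 2).layer 1) := 28417 + 5616 * xA + 1472 * bA + 1210 * bA * xA - 2548 * bA ^ 2 - 790 * bA ^ 2 * xA with hvdef
  have hv'unit : IsUnit v' := IsUnit.of_mul_eq_one _ hv'inv
  have hvunit : IsUnit v := IsUnit.of_mul_eq_one _ hvinv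
  have hNunit : ∀ {u : 𝓞 ↥(ℚ⟮θ⟯ ⊔ (CyclotomicZp.zpExtension 2).layer 1)}, IsUnit u → (Algebra.norm ℤ u).natAbs = 1 :=
    fun hu => Int.natAbs_of_isUnit (hu.map _)
  have hNη : (Algebra.norm ℤ η).natAbs = 2 := by
    have h : (Algebra.norm ℤ (v' * η ^ 2)).natAbs = 4 := by rw [← hpiq]; exact hNqA
    rw [map_mul, map_pow, Int.natAbs_mul, Int.natAbs_pow, hNunit hv'unit, one_mul] at h
    have hc : (Algebra.norm ℤ η).natAbs ≤ 2 := by nlinarith [h]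
    obtain h0 | h0 | h0 : (Algebra.norm ℤ η).natAbs = 0 ∨ (Algebra.norm ℤ η).natAbs = 1 ∨ (Algebra.norm ℤ η).natAbs = 2 := by omega
    · rw [h0] at h; norm_num at h
    · rw [h0] at h; norm_num at h
    · exact h0
  have hNξ : (Algebra.norm ℤ xA).natAbs = 2 := by
    have h : (Algebra.norm ℤ (v * xA ^ 2 * η ^ 4)).natAbs = 64 := by rw [htwo, norm_two_eq_sixtyfour hfinA]; rfl
    rw [map_mul, map_mul, map_pow, map_pow, Int.natAbs_mul, Int.natAbs_mul, Int.natAbs_pow, Int.natAbs_pow, hNunit hvunit,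
      one_mul, hNη] at h
    have hc : (Algebra.norm ℤ xA).natAbs ≤ 2 := by nlinarith [h]
    obtain h0 | h0 | h0 : (Algebra.norm ℤ xA).natAbs = 0 ∨ (Algebra.norm ℤ xA).natAbs = 1 ∨ (Algebra.norm ℤ xA).natAbs = 2 := by omega
    · rw [h0] at h; norm_num at h
    · rw [h0] at h; norm_num at h
    · exact h0
  have habsξ : Ideal.absNorm (Ideal.span {xA}) = 2 := by rw [Ideal.absNorm_span_singleton, hNξ]
  have habsη : Ideal.absNorm (Ideal.span {η}) = 2 := by rw [Ideal.absNorm_span_singleton, hNη]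
  have hPξ : (Ideal.span {xA}).IsPrime := Ideal.isPrime_of_irreducible_absNorm (by rw [habsξ]; exact Nat.prime_two)
  have hPη : (Ideal.span {η}).IsPrime := Ideal.isPrime_of_irreducible_absNorm (by rw [habsη]; exact Nat.prime_two)
  have hξ0 : xA ≠ 0 := by
    intro h0; rw [h0, Algebra.norm_zero] at hNξ; norm_num at hNξ
  have hprime : Prime xA := (Ideal.span_singleton_prime hξ0).mp hPξ
  have hcard : Nat.card (𝓞 ↥(ℚ⟮θ⟯ ⊔ (CyclotomicZp.zpExtension 2).layer 1) ⧸ Ideal.span {xA}) = 2 := by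
    rw [← Submodule.cardQuot_apply, ← Ideal.absNorm_apply, habsξ]
  have hres : ∀ z : 𝓞 ↥(ℚ⟮θ⟯ ⊔ (CyclotomicZp.zpExtension 2).layer 1), xA ∣ z ∨ xA ∣ z - 1 := by
    intro z
    by_cases hz : Ideal.Quotient.mk (Ideal.span {xA}) z = 0
    · exact Or.inl (Ideal.mem_span_singleton.mp (Ideal.Quotient.eq_zero_iff_mem.mp hz))
    · right
      have h10 : (1 : 𝓞 ↥(ℚ⟮θ⟯ ⊔ (CyclotomicZp.zpExtension 2).layer 1) ⧸ Ideal.span {xA}) ≠ 0 := by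
        haveI : Nontrivial (𝓞 ↥(ℚ⟮θ⟯ ⊔ (CyclotomicZp.zpExtension 2).layer 1) ⧸ Ideal.span {xA}) := Ideal.Quotient.nontrivial_iff.mpr hPξ.ne_top
        exact one_ne_zero
      obtain ⟨y, -, huniq⟩ := (Nat.card_eq_two_iff' (0 : 𝓞 ↥(ℚ⟮θ⟯ ⊔ (CyclotomicZp.zpExtension 2).layer 1) ⧸ Ideal.span {xA})).mp hcard
      have h1 : Ideal.Quotient.mk (Ideal.span {xA}) z = 1 := (huniq _ hz).trans (huniq _ h10).symm
      have h0 : Ideal.Quotient.mk (Ideal.span {xA}) (z - 1) = 0 := by rw [map_sub, h1, map_one, sub_self]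
      exact Ideal.mem_span_singleton.mp (Ideal.Quotient.eq_zero_iff_mem.mp h0)
  have hone : ∀ {y z : 𝓞 ↥(ℚ⟮θ⟯ ⊔ (CyclotomicZp.zpExtension 2).layer 1)}, y - 1 = xA * z → ¬ xA ∣ y := by
    rintro y z hyz ⟨c, hc⟩
    exact hprime.not_unit (isUnit_of_dvd_one ⟨c - z, by linear_combination hc - hyz⟩)
  have hnw : ¬ xA ∣ (1 + 2 * bA + bA ^ 2) := hone hw1
  have hnμ : ¬ xA ∣ (1 + xA + bA + 2 * bA * xA + bA ^ 2 * xA) := hone hmu1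
  refine ⟨bA, xA, sA, v, hbAval', rfl, ?_, RbA, RxA, hs, hsA2, hprime, hres, hnw, hnμ, hPξ, hPη, hvunit, htwo⟩
  rfl

/-- **`h(ℚ(θ) ⊔ ℚ_1)` is ODD** for `θ³ + (0)θ² + (-11)θ + (-8) = 0` (`ℚ(θ, √2)`, `d = 3596`): k4-w1's one-bit currency (`layerOneBit_d3596p`, Chevalley's door at `2`)
transported to the concrete model by the kit (`odd_classNumber_sup_layer_one_of_layerOneBit`). KERNEL. [cite: Lang1990, Ch. 13 §4, Lemma 4.1] [cite: Washington1997, §13.1] -/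
theorem odd_classNumber_adjoin_sup_layer_one_d3596 (hθ : aeval θ (Cubic.toPoly ⟨1, ((0 : ℤ) : ℚ), ((-11 : ℤ) : ℚ), ((-8 : ℤ) : ℚ)⟩) = 0) :
    haveI : FiniteDimensional ℚ ↥ℚ⟮θ⟯ :=
      IntermediateField.adjoin.finiteDimensional ⟨_, Cubic.monic_of_a_eq_one', by rwa [← aeval_def]⟩
    haveI : FiniteDimensional ℚ ↥((CyclotomicZp.zpExtension 2).layer 1) := (CyclotomicZp.zpExtension 2).finiteDimensional_layer_holds 1
    haveI : NumberField ↥(ℚ⟮θ⟯ ⊔ (CyclotomicZp.zpExtension 2).layer 1) := NumberField.mk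
    Odd (classNumber ↥(ℚ⟮θ⟯ ⊔ (CyclotomicZp.zpExtension 2).layer 1)) :=
  odd_classNumber_sup_layer_one_of_layerOneBit irreducible_cubic_d3596p hθ (layerOneBit_d3596p hθ)

end Summit.BirchSwinnertonDyer.BirchSwinnertonDyer.Theorems.AddKatoTwo

end
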